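import Summits.HubbardSuperconductivity.HubbardSuperconductivity.Theorems.AnisotropyChordFourTorusKernelEight
import Summits.HubbardSuperconductivity.HubbardSuperconductivity.Theorems.AnisotropyChordFourTorusKernelNine
import Summits.HubbardSuperconductivity.HubbardSuperconductivity.Theorems.AnisotropyChordFourTorusKernelLit

/-!
# Route `AnisotropyChord` / crux `FerroSideChord` at `M = 4`: KERNEL-EVALUATED symmetry bookkeeping of the `4 × 4` torus, III —
# reduced data, the certificate matrices `30·M(0)`, `30·M(1)` and their PSD certificates (prover seat `hubbard-h0-rotor-p1` g17)

Reduced data read off the representatives: `children ρ` (classes of the 9 weight-8 children of `rep9 ρ`), `ordPairs ρ`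
(for ordered adjacent sites `(i, j)` both occupied in `rep9 ρ`: the classes of `u − 2^i`, `u − 2^j`), `activeEdges r`
(ordered adjacent `(i, j)` with `i` empty, `j` occupied in `rep8 r`).  Tables `cnt`, `pqm` (built once, packed; read back through the packing lemma).  `pEntry D r s` — the integer matrix `30·M(D)`, `D ∈ {0,1}`
(`…FourTorusCertificate`); `pAgree_*` — it equals the packed literal `pLit D` of `…FourTorusKernelLit`; totals `brokenTotal_eq` (`Σ_r n8 r·A_r = 219648`), `n8_total`.
-/

set_option linter.style.longLine false
set_option linter.dupNamespace false
set_option autoImplicit false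

namespace Summit.HubbardSuperconductivity.HubbardSuperconductivity.Theorems.AnisotropyChord.FourTorus

/-! ## Reduced data -/

/-- classes of the 9 children `u − 2^i` (`i ∈ u`) of `u = rep9 ρ`. [folklore] -/
def children (ρ : ℕ) : List ℕ :=
  (List.range 16).filterMap fun i => bif Nat.testBit (rep9 ρ) i then some (cls (rep9 ρ ^^^ 2 ^ i)) else none
/-- for ordered adjacent `(i, j)` with `i, j ∈ u = rep9 ρ`: the classes of `u − 2^i` and `u − 2^j`. [folklore] -/
def ordPairs (ρ : ℕ) : List (ℕ × ℕ) :=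
  (List.range 16).flatMap fun i => (List.range 16).filterMap fun j =>
    bif adj16 i j && Nat.testBit (rep9 ρ) i && Nat.testBit (rep9 ρ) j then
      some (cls (rep9 ρ ^^^ 2 ^ i), cls (rep9 ρ ^^^ 2 ^ j)) else none
/-- ordered adjacent `(i, j)` with `i` empty and `j` occupied in `rep8 r` (= number of anti-aligned edges). [folklore] -/
def activeEdges (r : ℕ) : ℕ :=
  sumN 16 fun i => sumN 16 fun j => bif adj16 i j && !(Nat.testBit (rep8 r) i) && Nat.testBit (rep8 r) j then 1 else 0
/-- number of occurrences of `r` in a list. [folklore] -/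
def countIn (r : ℕ) (l : List ℕ) : ℕ := l.countP (· == r)
/-- number of occurrences of the pair `(p, q)` in a list. [folklore] -/
def countPair (p q : ℕ) (l : List (ℕ × ℕ)) : ℕ := l.countP fun x => x.1 == p && x.2 == q
/-- packed child-count table: 5-bit field `58 ρ + r` (built once; semantics by the packing lemma of `…FourTorusPacking`). [folklore] -/
def cntTab : ℕ := iter 56 (fun ρ acc => (children ρ).foldl (fun a c => a + 2 ^ (5 * (58 * ρ + c))) acc) 0
/-- packed ordered-pair table: 9-bit field `3364 ρ + 58 p + q` (built once). [folklore] -/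
def pqTab : ℕ := iter 56 (fun ρ acc => (ordPairs ρ).foldl (fun a pq => a + 2 ^ (9 * (3364 * ρ + (58 * pq.1 + pq.2)))) acc) 0
/-- child count read from the table. [folklore] -/
def cnt (ρ r : ℕ) : ℕ := field 5 cntTab (58 * ρ + r)
/-- ordered pair multiplicity read from the table. [folklore] -/
def pqm (ρ p q : ℕ) : ℕ := field 9 pqTab (3364 * ρ + (58 * p + q))


/-! ## The certificate matrices -/

/-- `L[r][s] = Σ_ρ n9 ρ · cnt ρ r · cnt ρ s` (Gram matrix of `‖S⁻ a‖²` in class variables). [folklore] -/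
def lEntry (r s : ℕ) : ℕ := sumN 56 fun ρ => n9 ρ * cnt ρ r * cnt ρ s
/-- `Σ_ρ n9 ρ · pqm ρ r s`. [folklore] -/
def hOff (r s : ℕ) : ℕ := sumN 56 fun ρ => n9 ρ * pqm ρ r s
/-- `Σ_s (hOff r s + hOff s r)`. [folklore] -/
def hDiag (r : ℕ) : ℕ := sumN 58 fun s => hOff r s + hOff s r
/-- `H[r][s] = [r = s]·hDiag r − hOff r s − hOff s r`: the matrix of `Σ_ρ n9 ρ Σ_{(p,q) ∈ ordPairs ρ} (v_p − v_q)²`. [folklore] -/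
def hEntry (r s : ℕ) : ℤ := (if r = s then (hDiag r : ℤ) else 0) - (hOff r s : ℤ) - (hOff s r : ℤ)
/-- the integer certificate matrix `30·M(D)`, `D ∈ {0, 1}` (`c = 30`, see `…FourTorusCertificate`):
`30 L + 225 H + δ_rs · n8 r · (−1080(1+D) + (1−D)(7200 − 450·A_r) + 480(1−D))`. [folklore] -/
def pEntry (D : ℕ) (r s : ℕ) : ℤ :=
  30 * (lEntry r s : ℤ) + 225 * hEntry r s +
    (if r = s then (n8 r : ℤ) * (-1080 * (1 + (D : ℤ)) + (1 - (D : ℤ)) * (7200 - 450 * (activeEdges r : ℤ))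
      + 480 * (1 - (D : ℤ))) else 0)

/-- rows `29 h ≤ r < 29 (h+1)` agree: `pEntry D r s = pLit D r s`. [folklore] -/
def pAgree (D h : ℕ) : Bool := allN 29 fun i => allN 58 fun s => pEntry D (29 * h + i) s == pLit D (29 * h + i) s


/-- `Σ_r n8 r · activeEdges r = 219648` (total number of anti-aligned edges over the sector). [folklore] -/
theorem brokenTotal_eq : sumN 58 (fun r => n8 r * activeEdges r) = 219648 := by decide +kernel
/-- `Σ_r n8 r = 12870`. [folklore] -/
theorem n8_total : sumN 58 n8 = 12870 := by decide +kernel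

end Summit.HubbardSuperconductivity.HubbardSuperconductivity.Theorems.AnisotropyChord.FourTorus
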